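import Mathlib
import Summits.RiemannHypothesis.RiemannHypothesis.Theorems.WeilFarFloorCoshCouplingRH
import Summits.RiemannHypothesis.RiemannHypothesis.Theorems.WeilFarFloorCoshTest
import Summits.RiemannHypothesis.RiemannHypothesis.Theorems.WeilFarFloorCouplingTransfer
import Summits.RiemannHypothesis.RiemannHypothesis.Theorems.WeilFarFloorCoshResidual
import Literature.NumberTheory.LFunctions.MertensFirstVonMangoldtUpper
import HarnessLib

/-!
# Tools: the residual of the cosh profile splits as `O + E` — Minkowski, the majorants of `E`, the Cramér form of `O`

Helper file (`--supports stmt-RiemannHypothesis-0098`, lead-track anchor: Weil-positivity window ladder, format-C far bound),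
pure proofs over BUILT imports.  Seat rh-explicit-weil-1 gen16 (memo `run/shared/lean/pub/rh-explicit/rh-explicit-weil-1/FORMAT-K3.md`
§17).

Objects (all inline, as in the second-order chain `WeilFarFloorSecondOrderLawRH`/`…ExactRH`): the cosh profile
`C_b = 1_{[−b,b]}cosh(·/2)` (`P = ∫C_b² = b + sinh b`), the prime-shift operator `T_b`, the cosh quotient `R_c(b) = Q_b(C_b)/P` and the
RESIDUAL ENERGY `J(b) = ∫_{(−b,b)}(T_bC_b − R_c(b)C_b)²/P` — under RH the coefficient of the floor gap,
`λ_max(a) = R_c(a) + (1 + o(1))J(a)/R_c(a) + o(e^{−a})`.  With the CRAMÉR FUNCTION `g(u) = e^{−u/2}(ψ(e^u) − e^u)`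
(mean square `β₂ = Σ_ρ m(ρ)²/|ρ|²`, MV Thm. 13.6) and its lag-`2b` autocorrelation energy
`Φ(b) = ∫₀^{2b} (g(u) + g(2b − u))² du`, the companion file `WeilFarFloorResidualEnergyCramer` proves
`RH → ∃ C b₀, ∀ b ≥ b₀, |√J(b) − ½·√(e^b/P)·√Φ(b)| ≤ C`; this file holds its RH-free TOOLS: the closed form `T_bC_b − (e^b + b)C_b = x sinh(x/2) + Mertens terms + O(x)`
(`FloorCoshSplit.primeShiftOp_coshProfile_sub_eq`) with `O(x) = ½e^{b/2}(g(b+x) + g(b−x))`; the residual is `r = O + E` where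
`E = [x sinh(x/2) − (b−1)cosh(x/2)] + [Mertens terms] + (e^b + 2b − 1 − R_c(b))cosh(x/2)` has `∫E² ≤ 288·P` — the geometric
bracket by `(1−s)² ≤ 16e^{s/2}`, the Mertens bracket by `|Σ_{n≤y}Λ(n)/n − log y| ≤ 4` (Literature `MertensFirstUpper`, tree
`FloorCosh.vonMangoldt_div_sum_ge`), and the last by the RH floor law for the cosh quotient
`|R_c(b) − (e^b + 2b − 2 − 2γ)| ≤ β + 1` eventually (in the companion) — here: Minkowski in `L²(μ)` (`sqrt_integral_add_sq_le`), the
window integrals `∫_{(−b,b)}cosh²(x/2) = P`, `∫_{(−b,b)}e^{b/2}cosh(x/2) = 2(e^b − 1)`, the pointwise majorant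
`E² ≤ 3(16e^{b/2}cosh(x/2) + 16cosh²(x/2) + (b−1−κ)²cosh²(x/2))` (`residual_sub_osc_sq_le`, `κ = R − e^b − b` for ANY real `R`),
`∫_{(−b,b)}O² = (e^b/4)Φ(b)` (`setIntegral_osc_sq_eq`), measurability of the residual, measurability and window bound of `O` (the residual's bound is the tree's
`FloorSecondOrder.abs_residualCore_le`).  Everything here is RH-free.  Standard axioms only.  Nothing here bears on the truth of RH.
-/

set_option linter.dupNamespace false
set_option autoImplicit false

noncomputable section

open MeasureTheory Set Filter Topology
open scoped Real BigOperators ArithmeticFunction.vonMangoldt Chebyshev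

namespace Summit.RiemannHypothesis.RiemannHypothesis.Theorems.WeilFormatC

namespace FloorResidualMean

open Literature.NumberTheory.LFunctions FloorCosh FloorCoshSplit

variable {b : ℝ}

/-! ## §1 Elementary tools: Minkowski in `L²(S)`, integrability of bounded functions on the window -/

/-- Cauchy–Schwarz for a general measure: `(∫fg)² ≤ (∫f²)(∫g²)`. -/
theorem sq_integral_mul_le_of_measure {μ : Measure ℝ} {f g : ℝ → ℝ} (hff : Integrable (fun x ↦ f x ^ 2) μ)
    (hfg : Integrable (fun x ↦ f x * g x) μ) (hgg : Integrable (fun x ↦ g x ^ 2) μ) :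
    (∫ x, f x * g x ∂μ) ^ 2 ≤ (∫ x, f x ^ 2 ∂μ) * ∫ x, g x ^ 2 ∂μ := by
  set A := ∫ x, f x ^ 2 ∂μ with hA
  set B := ∫ x, f x * g x ∂μ with hB
  set Cc := ∫ x, g x ^ 2 ∂μ with hCc
  have hnn : ∀ t : ℝ, 0 ≤ A - 2 * t * B + t ^ 2 * Cc := by
    intro t
    have hpt : (fun x ↦ (f x - t * g x) ^ 2) = fun x ↦ f x ^ 2 - 2 * t * (f x * g x) + t ^ 2 * g x ^ 2 := by
      funext x; ring
    have i1 : Integrable (fun x ↦ f x ^ 2 - 2 * t * (f x * g x)) μ := hff.sub (hfg.const_mul _)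
    have i2 : Integrable (fun x ↦ t ^ 2 * g x ^ 2) μ := hgg.const_mul _
    have h0 : 0 ≤ ∫ x, (f x - t * g x) ^ 2 ∂μ := integral_nonneg fun x ↦ sq_nonneg _
    rw [hpt, integral_add i1 i2, integral_sub hff (hfg.const_mul _), integral_const_mul, integral_const_mul] at h0
    rw [hA, hB, hCc]; linarith
  have hC0 : 0 ≤ Cc := integral_nonneg fun x ↦ sq_nonneg _
  rcases hC0.eq_or_lt with hC0' | hCpos
  · have hB0 : B = 0 := by
      by_contra hne
      have h1 := hnn ((A + 1) / (2 * B))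
      rw [← hC0', mul_zero, add_zero] at h1
      have h2 : 2 * ((A + 1) / (2 * B)) * B = A + 1 := by field_simp
      linarith
    rw [hB0, ← hC0']; simp
  · have h1 := hnn (B / Cc)
    have h2 : A - 2 * (B / Cc) * B + (B / Cc) ^ 2 * Cc = (A * Cc - B ^ 2) / Cc := by field_simp; ring
    rw [h2] at h1
    rcases div_nonneg_iff.1 h1 with ⟨h3, -⟩ | ⟨-, h4⟩
    · linarith
    · linarith

/-- **Minkowski in `L²(μ)`**: `√∫(f+g)² ≤ √∫f² + √∫g²`. -/
theorem sqrt_integral_add_sq_le {μ : Measure ℝ} {f g : ℝ → ℝ} (hff : Integrable (fun x ↦ f x ^ 2) μ)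
    (hfg : Integrable (fun x ↦ f x * g x) μ) (hgg : Integrable (fun x ↦ g x ^ 2) μ) :
    Real.sqrt (∫ x, (f x + g x) ^ 2 ∂μ) ≤ Real.sqrt (∫ x, f x ^ 2 ∂μ) + Real.sqrt (∫ x, g x ^ 2 ∂μ) := by
  set A := ∫ x, f x ^ 2 ∂μ with hA
  set B := ∫ x, f x * g x ∂μ with hB
  set Cc := ∫ x, g x ^ 2 ∂μ with hCc
  have hA0 : 0 ≤ A := integral_nonneg fun x ↦ sq_nonneg _
  have hC0 : 0 ≤ Cc := integral_nonneg fun x ↦ sq_nonneg _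
  have hcs : B ^ 2 ≤ A * Cc := sq_integral_mul_le_of_measure hff hfg hgg
  have hB : B ≤ Real.sqrt A * Real.sqrt Cc := by
    rw [← Real.sqrt_mul hA0]
    exact Real.le_sqrt_of_sq_le hcs
  have hsum : ∫ x, (f x + g x) ^ 2 ∂μ = A + 2 * B + Cc := by
    have hpt : (fun x ↦ (f x + g x) ^ 2) = fun x ↦ f x ^ 2 + 2 * (f x * g x) + g x ^ 2 := by funext x; ring
    have i0 : Integrable (fun x ↦ 2 * (f x * g x)) μ := hfg.const_mul 2
    have i1 : Integrable (fun x ↦ f x ^ 2 + 2 * (f x * g x)) μ := hff.add i0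
    rw [hpt, integral_add i1 hgg, integral_add hff i0, integral_const_mul]
  rw [hsum]
  have hs0 : 0 ≤ Real.sqrt A + Real.sqrt Cc := by positivity
  refine Real.sqrt_le_iff.2 ⟨hs0, ?_⟩
  nlinarith [Real.sq_sqrt hA0, Real.sq_sqrt hC0]

/-- A measurable function bounded on the window is integrable there. -/
theorem integrableOn_window_of_bounded {f : ℝ → ℝ} (hf : Measurable f) {M : ℝ} (hM : ∀ x ∈ Ioo (-b) b, |f x| ≤ M) :
    IntegrableOn f (Ioo (-b) b) := by
  refine Measure.integrableOn_of_bounded (by simp [Real.volume_Ioo]) hf.aestronglyMeasurable (M := M) ?_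
  exact (ae_restrict_iff' measurableSet_Ioo).2 (ae_of_all _ fun x hx ↦ by rw [Real.norm_eq_abs]; exact hM x hx)

/-- Products of measurable functions bounded on the window are integrable there. -/
theorem integrableOn_window_mul {f g : ℝ → ℝ} (hf : Measurable f) (hg : Measurable g) {Mf Mg : ℝ}
    (hMf : ∀ x ∈ Ioo (-b) b, |f x| ≤ Mf) (hMg : ∀ x ∈ Ioo (-b) b, |g x| ≤ Mg) :
    IntegrableOn (fun x ↦ f x * g x) (Ioo (-b) b) := by
  refine integrableOn_window_of_bounded (hf.mul hg) (M := Mf * Mg) fun x hx ↦ ?_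
  rw [abs_mul]
  exact mul_le_mul (hMf x hx) (hMg x hx) (abs_nonneg _) ((abs_nonneg _).trans (hMf x hx))

/-! ## §2 The window integrals of the majorants -/

/-- `∫_{(−b,b)} cosh²(x/2) = b + sinh b = P`. -/
theorem setIntegral_cosh_half_sq (hb : 0 ≤ b) : ∫ x in Ioo (-b) b, Real.cosh (x / 2) ^ 2 = b + Real.sinh b := by
  have h := integral_coshTest_sq hb
  have hpt : (fun x ↦ (Icc (-b) b).indicator (fun y ↦ Real.cosh (y / 2)) x ^ 2)
      = (Icc (-b) b).indicator (fun y ↦ Real.cosh (y / 2) ^ 2) := by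
    funext x
    by_cases hx : x ∈ Icc (-b) b
    · rw [indicator_of_mem hx, indicator_of_mem hx]
    · rw [indicator_of_notMem hx, indicator_of_notMem hx]; ring
  rw [hpt, integral_indicator measurableSet_Icc, integral_Icc_eq_integral_Ioo] at h
  exact h

/-- `∫_{(−b,b)} cosh(x/2) = 4 sinh(b/2)` and `e^{b/2}·4 sinh(b/2) = 2(e^b − 1)`: **`∫_{(−b,b)} e^{b/2}cosh(x/2) = 2(e^b − 1)`**. -/
theorem setIntegral_exp_mul_cosh_half (hb : 0 ≤ b) :
    ∫ x in Ioo (-b) b, Real.exp (b / 2) * Real.cosh (x / 2) = 2 * (Real.exp b - 1) := by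
  have hderiv : ∀ x ∈ uIcc (-b) b, HasDerivAt (fun x ↦ 2 * Real.sinh (x / 2)) (Real.cosh (x / 2)) x := by
    intro x _
    have h1 : HasDerivAt (fun y : ℝ ↦ y / 2) (1 / 2) x := (hasDerivAt_id' x).div_const 2
    exact (h1.sinh.const_mul 2).congr_deriv (by ring)
  have hint : IntervalIntegrable (fun x ↦ Real.cosh (x / 2)) volume (-b) b :=
    (Real.continuous_cosh.comp (continuous_id.div_const 2)).intervalIntegrable _ _
  rw [MeasureTheory.integral_const_mul, ← integral_Icc_eq_integral_Ioo, integral_Icc_eq_integral_Ioc,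
    ← intervalIntegral.integral_of_le (by linarith), intervalIntegral.integral_eq_sub_of_hasDerivAt hderiv hint]
  have e1 : Real.exp (b / 2) * Real.sinh (b / 2) = (Real.exp b - 1) / 2 := by
    rw [Real.sinh_eq, show Real.exp b = Real.exp (b / 2) * Real.exp (b / 2) by rw [← Real.exp_add]; ring_nf,
      show Real.exp (-(b / 2)) = (Real.exp (b / 2))⁻¹ by rw [Real.exp_neg]]
    field_simp
  rw [neg_div, Real.sinh_neg]
  nlinarith [e1]

/-- The elementary inequality behind the geometric bracket: `(1 − s)² ≤ 16·e^{s/2}` for `s ≥ 0`. -/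
theorem one_sub_sq_le_exp {s : ℝ} (hs : 0 ≤ s) : (1 - s) ^ 2 ≤ 16 * Real.exp (s / 2) := by
  have h := Real.quadratic_le_exp_of_nonneg (x := s / 2) (by linarith)
  nlinarith [sq_nonneg s]

/-- **The geometric bracket**: `(x sinh(x/2) − (b−1)cosh(x/2))² ≤ 16e^{b/2}cosh(x/2)` for `|x| < b`
(`x sinh(x/2) − (b−1)cosh(x/2) = ½[(x−b+1)e^{x/2} − (x+b−1)e^{−x/2}]` and `(1−s)² ≤ 16e^{s/2}`). -/
theorem geom_sq_le {x : ℝ} (hx : x ∈ Ioo (-b) b) :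
    (x * Real.sinh (x / 2) - (b - 1) * Real.cosh (x / 2)) ^ 2 ≤ 16 * (Real.exp (b / 2) * Real.cosh (x / 2)) := by
  have h1 : x * Real.sinh (x / 2) - (b - 1) * Real.cosh (x / 2)
      = ((x - b + 1) * Real.exp (x / 2) - (x + b - 1) * Real.exp (-(x / 2))) / 2 := by
    rw [Real.sinh_eq, Real.cosh_eq]; ring
  have hp : 0 < Real.exp (x / 2) := Real.exp_pos _
  have hm : 0 < Real.exp (-(x / 2)) := Real.exp_pos _
  have ha : (x - b + 1) ^ 2 ≤ 16 * Real.exp ((b - x) / 2) := by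
    rw [show (x - b + 1) ^ 2 = (1 - (b - x)) ^ 2 by ring]
    exact one_sub_sq_le_exp (by linarith [hx.2])
  have hb' : (x + b - 1) ^ 2 ≤ 16 * Real.exp ((b + x) / 2) := by
    rw [show (x + b - 1) ^ 2 = (1 - (b + x)) ^ 2 by ring]
    exact one_sub_sq_le_exp (by linarith [hx.1])
  -- (p − q)²/4 ≤ (p² + q²)/2
  have hsq : ((x - b + 1) * Real.exp (x / 2) - (x + b - 1) * Real.exp (-(x / 2))) ^ 2 / 4
      ≤ ((x - b + 1) ^ 2 * Real.exp (x / 2) ^ 2 + (x + b - 1) ^ 2 * Real.exp (-(x / 2)) ^ 2) / 2 := by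
    nlinarith [sq_nonneg ((x - b + 1) * Real.exp (x / 2) + (x + b - 1) * Real.exp (-(x / 2)))]
  have e1 : Real.exp ((b - x) / 2) * Real.exp (x / 2) ^ 2 = Real.exp (b / 2) * Real.exp (x / 2) := by
    rw [sq, ← Real.exp_add, ← Real.exp_add, ← Real.exp_add]; ring_nf
  have e2 : Real.exp ((b + x) / 2) * Real.exp (-(x / 2)) ^ 2 = Real.exp (b / 2) * Real.exp (-(x / 2)) := by
    rw [sq, ← Real.exp_add, ← Real.exp_add, ← Real.exp_add]; ring_nf
  have hc : Real.cosh (x / 2) = (Real.exp (x / 2) + Real.exp (-(x / 2))) / 2 := Real.cosh_eq _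
  rw [h1, div_pow, show ((2 : ℝ) ^ 2) = 4 by norm_num, hc]
  have t1 : (x - b + 1) ^ 2 * Real.exp (x / 2) ^ 2 ≤ 16 * (Real.exp (b / 2) * Real.exp (x / 2)) := by
    calc (x - b + 1) ^ 2 * Real.exp (x / 2) ^ 2 ≤ 16 * Real.exp ((b - x) / 2) * Real.exp (x / 2) ^ 2 :=
          mul_le_mul_of_nonneg_right ha (sq_nonneg _)
      _ = 16 * (Real.exp (b / 2) * Real.exp (x / 2)) := by rw [mul_assoc, e1]
  have t2 : (x + b - 1) ^ 2 * Real.exp (-(x / 2)) ^ 2 ≤ 16 * (Real.exp (b / 2) * Real.exp (-(x / 2))) := by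
    calc (x + b - 1) ^ 2 * Real.exp (-(x / 2)) ^ 2 ≤ 16 * Real.exp ((b + x) / 2) * Real.exp (-(x / 2)) ^ 2 :=
          mul_le_mul_of_nonneg_right hb' (sq_nonneg _)
      _ = 16 * (Real.exp (b / 2) * Real.exp (-(x / 2))) := by rw [mul_assoc, e2]
  linarith

/-- **The Mertens bracket**: with `H(y) = Σ_{0<n≤y}Λ(n)/n`, `|H(y) − log y| ≤ 4` for `y ≥ 1`
(Literature `MertensFirstUpper.sum_vonMangoldt_div_floor_le_log_add` and the tree's `FloorCosh.vonMangoldt_div_sum_ge`). -/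
theorem abs_vonMangoldt_div_sum_sub_log_le {y : ℝ} (hy : 1 ≤ y) :
    |(∑ n ∈ Finset.Ioc 0 ⌊y⌋₊, (Λ n : ℝ) / n) - Real.log y| ≤ 4 := by
  have h1 := MertensFirstUpper.sum_vonMangoldt_div_floor_le_log_add hy
  have h2 := vonMangoldt_div_sum_ge hy
  rw [abs_le]; constructor <;> linarith

/-- The Mertens terms of the closed form are at most `4cosh(x/2)` in absolute value on the window. -/
theorem mertens_abs_le {x : ℝ} (hx : x ∈ Ioo (-b) b) :
    |(Real.exp (x / 2) / 2 * ((∑ n ∈ Finset.Ioc 0 ⌊Real.exp (b + x)⌋₊, (Λ n : ℝ) / n) - (b + x))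
        + Real.exp (-(x / 2)) / 2 * ((∑ n ∈ Finset.Ioc 0 ⌊Real.exp (b - x)⌋₊, (Λ n : ℝ) / n) - (b - x)))|
      ≤ 4 * Real.cosh (x / 2) := by
  have hp : 0 < Real.exp (x / 2) := Real.exp_pos _
  have hm : 0 < Real.exp (-(x / 2)) := Real.exp_pos _
  have h1 := abs_vonMangoldt_div_sum_sub_log_le (y := Real.exp (b + x)) (Real.one_le_exp (by linarith [hx.1]))
  have h2 := abs_vonMangoldt_div_sum_sub_log_le (y := Real.exp (b - x)) (Real.one_le_exp (by linarith [hx.2]))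
  rw [Real.log_exp] at h1 h2
  rw [Real.cosh_eq]
  calc |Real.exp (x / 2) / 2 * ((∑ n ∈ Finset.Ioc 0 ⌊Real.exp (b + x)⌋₊, (Λ n : ℝ) / n) - (b + x))
        + Real.exp (-(x / 2)) / 2 * ((∑ n ∈ Finset.Ioc 0 ⌊Real.exp (b - x)⌋₊, (Λ n : ℝ) / n) - (b - x))|
      ≤ |Real.exp (x / 2) / 2 * ((∑ n ∈ Finset.Ioc 0 ⌊Real.exp (b + x)⌋₊, (Λ n : ℝ) / n) - (b + x))|
        + |Real.exp (-(x / 2)) / 2 * ((∑ n ∈ Finset.Ioc 0 ⌊Real.exp (b - x)⌋₊, (Λ n : ℝ) / n) - (b - x))| :=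
        abs_add_le _ _
    _ ≤ Real.exp (x / 2) / 2 * 4 + Real.exp (-(x / 2)) / 2 * 4 := by
        rw [abs_mul, abs_mul, abs_of_pos (by positivity : (0 : ℝ) < Real.exp (x / 2) / 2),
          abs_of_pos (by positivity : (0 : ℝ) < Real.exp (-(x / 2)) / 2)]
        gcongr
    _ = 4 * ((Real.exp (x / 2) + Real.exp (-(x / 2))) / 2) := by ring

/-! ## §3 The oscillatory part `O` and the Cramér autocorrelation energy -/

/-- **`O(x)² = (e^b/4)·(g(b+x) + g(b−x))²`** with `g(u) = e^{−u/2}(ψ(e^u) − e^u)`,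
`O(x) = ½[e^{x/2}(ψ(e^{b−x}) − e^{b−x}) + e^{−x/2}(ψ(e^{b+x}) − e^{b+x})]`. -/
theorem osc_sq_eq (b x : ℝ) :
    ((Real.exp (x / 2) * (ψ (Real.exp (b - x)) - Real.exp (b - x))
        + Real.exp (-(x / 2)) * (ψ (Real.exp (b + x)) - Real.exp (b + x))) / 2) ^ 2
      = Real.exp b / 4 * (Real.exp (-((b + x) / 2)) * (ψ (Real.exp (b + x)) - Real.exp (b + x))
          + Real.exp (-((b - x) / 2)) * (ψ (Real.exp (b - x)) - Real.exp (b - x))) ^ 2 := by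
  have e1 : Real.exp (x / 2) = Real.exp (b / 2) * Real.exp (-((b - x) / 2)) := by
    rw [← Real.exp_add]; ring_nf
  have e2 : Real.exp (-(x / 2)) = Real.exp (b / 2) * Real.exp (-((b + x) / 2)) := by
    rw [← Real.exp_add]; ring_nf
  have e3 : Real.exp b = Real.exp (b / 2) ^ 2 := by rw [sq, ← Real.exp_add]; ring_nf
  rw [e1, e2, e3]; ring

/-- **`∫_{(−b,b)} O² = (e^b/4)·Φ(b)`**, `Φ(b) = ∫₀^{2b}(g(u) + g(2b−u))² du` (`u = b + x`). -/
theorem setIntegral_osc_sq_eq (hb : 0 ≤ b) :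
    ∫ x in Ioo (-b) b, ((Real.exp (x / 2) * (ψ (Real.exp (b - x)) - Real.exp (b - x))
        + Real.exp (-(x / 2)) * (ψ (Real.exp (b + x)) - Real.exp (b + x))) / 2) ^ 2
      = Real.exp b / 4 * ∫ u in (0 : ℝ)..(2 * b),
          (Real.exp (-(u / 2)) * (ψ (Real.exp u) - Real.exp u)
            + Real.exp (-((2 * b - u) / 2)) * (ψ (Real.exp (2 * b - u)) - Real.exp (2 * b - u))) ^ 2 := by
  simp_rw [osc_sq_eq]
  rw [MeasureTheory.integral_const_mul, ← integral_Ioc_eq_integral_Ioo, ← intervalIntegral.integral_of_le (by linarith)]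
  congr 1
  have h := intervalIntegral.integral_comp_add_left
    (fun u ↦ (Real.exp (-(u / 2)) * (ψ (Real.exp u) - Real.exp u)
      + Real.exp (-((2 * b - u) / 2)) * (ψ (Real.exp (2 * b - u)) - Real.exp (2 * b - u))) ^ 2) (a := -b) (b := b) b
  rw [show b + -b = 0 by ring, show b + b = 2 * b by ring] at h
  rw [← h]
  refine intervalIntegral.integral_congr fun x _ ↦ ?_
  have e : 2 * b - (b + x) = b - x := by ring
  simp only [e]

/-! ## §4 The residual is `O + E` with `∫E² ≤ 288·P` (under RH, eventually) -/

/-- **The decomposition of the residual**, pointwise on the window: with `κ = R − e^b − b`,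
`T_bC_b − R·C_b − O = [x sinh(x/2) − (b−1)cosh(x/2)] + [Mertens terms] + (b − 1 − κ)cosh(x/2)`. -/
theorem residual_sub_osc_eq (R : ℝ) {x : ℝ} (hx : x ∈ Ioo (-b) b) :
    (∑ n ∈ weilPrimeIndex b, (Λ n : ℝ) / Real.sqrt n *
        ((Icc (-b) b).indicator (fun y ↦ Real.cosh (y / 2)) (x - Real.log n)
          + (Icc (-b) b).indicator (fun y ↦ Real.cosh (y / 2)) (x + Real.log n)))
      - R * (Icc (-b) b).indicator (fun y ↦ Real.cosh (y / 2)) x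
      - (Real.exp (x / 2) * (ψ (Real.exp (b - x)) - Real.exp (b - x))
          + Real.exp (-(x / 2)) * (ψ (Real.exp (b + x)) - Real.exp (b + x))) / 2
    = (x * Real.sinh (x / 2) - (b - 1) * Real.cosh (x / 2))
      + (Real.exp (x / 2) / 2 * ((∑ n ∈ Finset.Ioc 0 ⌊Real.exp (b + x)⌋₊, (Λ n : ℝ) / n) - (b + x))
          + Real.exp (-(x / 2)) / 2 * ((∑ n ∈ Finset.Ioc 0 ⌊Real.exp (b - x)⌋₊, (Λ n : ℝ) / n) - (b - x)))
      + (b - 1 - (R - Real.exp b - b)) * Real.cosh (x / 2) := by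
  have h := primeShiftOp_coshProfile_sub_eq (b := b) hx
  have hxI : x ∈ Icc (-b) b := ⟨hx.1.le, hx.2.le⟩
  have hC : (Icc (-b) b).indicator (fun y ↦ Real.cosh (y / 2)) x = Real.cosh (x / 2) :=
    Set.indicator_of_mem hxI (fun y ↦ Real.cosh (y / 2))
  rw [hC] at h ⊢
  linear_combination h

/-- **Pointwise majorant of `E²` on the window**: `E(x)² ≤ 3(16e^{b/2}cosh(x/2) + 16cosh²(x/2) + (b−1−κ)²cosh²(x/2))`. -/
theorem residual_sub_osc_sq_le (R : ℝ) {x : ℝ} (hx : x ∈ Ioo (-b) b) :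
    ((∑ n ∈ weilPrimeIndex b, (Λ n : ℝ) / Real.sqrt n *
        ((Icc (-b) b).indicator (fun y ↦ Real.cosh (y / 2)) (x - Real.log n)
          + (Icc (-b) b).indicator (fun y ↦ Real.cosh (y / 2)) (x + Real.log n)))
      - R * (Icc (-b) b).indicator (fun y ↦ Real.cosh (y / 2)) x
      - (Real.exp (x / 2) * (ψ (Real.exp (b - x)) - Real.exp (b - x))
          + Real.exp (-(x / 2)) * (ψ (Real.exp (b + x)) - Real.exp (b + x))) / 2) ^ 2
    ≤ 3 * (16 * (Real.exp (b / 2) * Real.cosh (x / 2)) + 16 * Real.cosh (x / 2) ^ 2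
        + (b - 1 - (R - Real.exp b - b)) ^ 2 * Real.cosh (x / 2) ^ 2) := by
  rw [residual_sub_osc_eq R hx]
  have h3sq : ∀ p q r : ℝ, (p + q + r) ^ 2 ≤ 3 * (p ^ 2 + q ^ 2 + r ^ 2) := fun p q r ↦ by
    nlinarith [sq_nonneg (p - q), sq_nonneg (q - r), sq_nonneg (p - r)]
  refine (h3sq _ _ _).trans ?_
  have h1 := geom_sq_le hx
  have h2 : (Real.exp (x / 2) / 2 * ((∑ n ∈ Finset.Ioc 0 ⌊Real.exp (b + x)⌋₊, (Λ n : ℝ) / n) - (b + x))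
      + Real.exp (-(x / 2)) / 2 * ((∑ n ∈ Finset.Ioc 0 ⌊Real.exp (b - x)⌋₊, (Λ n : ℝ) / n) - (b - x))) ^ 2
      ≤ 16 * Real.cosh (x / 2) ^ 2 := by
    have hM := abs_le.1 (mertens_abs_le hx)
    calc (Real.exp (x / 2) / 2 * ((∑ n ∈ Finset.Ioc 0 ⌊Real.exp (b + x)⌋₊, (Λ n : ℝ) / n) - (b + x))
          + Real.exp (-(x / 2)) / 2 * ((∑ n ∈ Finset.Ioc 0 ⌊Real.exp (b - x)⌋₊, (Λ n : ℝ) / n) - (b - x))) ^ 2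
        ≤ (4 * Real.cosh (x / 2)) ^ 2 := sq_le_sq' hM.1 hM.2
      _ = 16 * Real.cosh (x / 2) ^ 2 := by ring
  have h3 : ((b - 1 - (R - Real.exp b - b)) * Real.cosh (x / 2)) ^ 2
      = (b - 1 - (R - Real.exp b - b)) ^ 2 * Real.cosh (x / 2) ^ 2 := by ring
  rw [h3]
  linarith

/-! ## §5 Measurability and window bounds of the residual and of `O` -/

/-- `O` is measurable (`ψ` is monotone). -/
theorem measurable_osc (b : ℝ) :
    Measurable (fun x : ℝ ↦ (Real.exp (x / 2) * (ψ (Real.exp (b - x)) - Real.exp (b - x))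
        + Real.exp (-(x / 2)) * (ψ (Real.exp (b + x)) - Real.exp (b + x))) / 2) := by
  have hψ : Measurable ψ := Chebyshev.psi_mono.measurable
  have hm : Measurable fun x : ℝ ↦ Real.exp (b - x) := Real.measurable_exp.comp (measurable_const.sub measurable_id)
  have hp : Measurable fun x : ℝ ↦ Real.exp (b + x) := Real.measurable_exp.comp (measurable_const.add measurable_id)
  have h1 : Measurable fun x : ℝ ↦ Real.exp (x / 2) := Real.measurable_exp.comp (measurable_id.div_const 2)
  have h2 : Measurable fun x : ℝ ↦ Real.exp (-(x / 2)) := Real.measurable_exp.comp (measurable_id.div_const 2).neg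
  exact ((h1.mul ((hψ.comp hm).sub hm)).add (h2.mul ((hψ.comp hp).sub hp))).div_const 2

/-- `|O(x)| ≤ e^b·(ψ(e^{2b}) + e^{2b})` on the window. -/
theorem abs_osc_le {x : ℝ} (hx : x ∈ Ioo (-b) b) :
    |(Real.exp (x / 2) * (ψ (Real.exp (b - x)) - Real.exp (b - x))
        + Real.exp (-(x / 2)) * (ψ (Real.exp (b + x)) - Real.exp (b + x))) / 2|
      ≤ Real.exp b * (ψ (Real.exp (2 * b)) + Real.exp (2 * b)) := by
  set K := ψ (Real.exp (2 * b)) + Real.exp (2 * b) with hK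
  have hK0 : 0 ≤ K := by have := Chebyshev.psi_nonneg (Real.exp (2 * b)); positivity
  have hbd : ∀ u : ℝ, u ≤ 2 * b → |ψ (Real.exp u) - Real.exp u| ≤ K := by
    intro u hu
    have h1 : ψ (Real.exp u) ≤ ψ (Real.exp (2 * b)) := Chebyshev.psi_mono (Real.exp_le_exp.2 hu)
    have h2 : Real.exp u ≤ Real.exp (2 * b) := Real.exp_le_exp.2 hu
    have h3 := Chebyshev.psi_nonneg (Real.exp u)
    have h4 := (Real.exp_pos u).le
    rw [abs_le]; constructor <;> linarith
  have e1 : Real.exp (x / 2) ≤ Real.exp b := Real.exp_le_exp.2 (by linarith [hx.1, hx.2])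
  have e2 : Real.exp (-(x / 2)) ≤ Real.exp b := Real.exp_le_exp.2 (by linarith [hx.1, hx.2])
  have hm := hbd (b - x) (by linarith [hx.1])
  have hp := hbd (b + x) (by linarith [hx.2])
  rw [abs_div, abs_two]
  calc |Real.exp (x / 2) * (ψ (Real.exp (b - x)) - Real.exp (b - x))
        + Real.exp (-(x / 2)) * (ψ (Real.exp (b + x)) - Real.exp (b + x))| / 2
      ≤ (|Real.exp (x / 2) * (ψ (Real.exp (b - x)) - Real.exp (b - x))|
        + |Real.exp (-(x / 2)) * (ψ (Real.exp (b + x)) - Real.exp (b + x))|) / 2 :=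
        div_le_div_of_nonneg_right (abs_add_le _ _) (by norm_num)
    _ ≤ (Real.exp b * K + Real.exp b * K) / 2 := by
        rw [abs_mul, abs_mul, abs_of_pos (Real.exp_pos _), abs_of_pos (Real.exp_pos _)]
        gcongr
    _ = Real.exp b * K := by ring

/-- The residual `T_bC_b − R·C_b` is measurable. -/
theorem measurable_residual (b R : ℝ) :
    Measurable (fun x : ℝ ↦ (∑ n ∈ weilPrimeIndex b, (Λ n : ℝ) / Real.sqrt n *
        ((Icc (-b) b).indicator (fun y ↦ Real.cosh (y / 2)) (x - Real.log n)
          + (Icc (-b) b).indicator (fun y ↦ Real.cosh (y / 2)) (x + Real.log n)))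
      - R * (Icc (-b) b).indicator (fun y ↦ Real.cosh (y / 2)) x) := by
  obtain ⟨hCm, -, -⟩ := coshTest_admissible b
  exact (measurable_primeShiftOp (b' := b) hCm).sub (hCm.const_mul R)

end FloorResidualMean

end Summit.RiemannHypothesis.RiemannHypothesis.Theorems.WeilFormatC
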